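import Mathlib
import HarnessLib
import Summits.HubbardSuperconductivity.HubbardSuperconductivity.Theorems.FunctionFieldCertificateWindowInfraredBoundReductions

/-!
# Crux `WindowInfraredBound` (stmt-HubbardSuperconductivity-1089), line `dyadic-halving-cascade`:
# stub `stub_shellCover` — the single-state Littlewood–Paley shell cover and the geometric cascade

Notation: `S_ψ(m) = pairStructureFactor dWaveFormFactor L ψ m ≥ 0`, `|q_m|² = momentumNormSq L m`,
`φ(u) = max 0 (1 − |log₂ u|)` (log-tent, `0 ≤ φ ≤ 1`, `φ(v) + φ(2v) = 1` on `[1/2, 1]`), and the smooth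
dyadic shell sums `f(k) = Σ_{m ≠ 0} φ(|q_m| / ρ_k) S_ψ(m)` at the scales `ρ_k = ε₀ 2^{-k}`.

For ONE Fock vector `ψ` with `⟨ψ, ψ⟩ = 1` obeying the halving inequality (Dbl)
`f(ρ) ≤ f(2ρ)/2 + B₁ρ²L² + B₂L` at every scale `0 < ρ ≤ ε₀/2`, the sharp window sum obeys, for
`0 < ε ≤ ε₀/2`,

  `Σ_{m ≠ 0, |q_m|² ≤ ε²} S_ψ(m) ≤ (8(32 + B₁ε₀²)/ε₀ + 4B₂) · ε · L²`.

Proof (all elementary):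
* anchor `f(k) ≤ Σ_m S_ψ(m) ≤ 32L²` (landed Parseval ceiling `wib_sum_pairStructureFactor_le`);
* (Dbl) at `ρ = ρ_{k+1}` reads `f(k+1) ≤ f(k)/2 + B₁ε₀²L²/4^{k+1} + B₂L`, and the closed-form cascade
  `shellCover_cascade_bound` gives `f(k) ≤ (32 + B₁ε₀²)L²/2^k + 2B₂L`;
* cover: for `m ≠ 0` in the window, `u = |q_m| ∈ [2π/L, ε]`; the dyadic scale `k*` with
  `ρ_{k*}/2 ≤ u ≤ ρ_{k*}` gives `S_ψ(m) = (φ(u/ρ_{k*}) + φ(u/ρ_{k*+1})) S_ψ(m)`, and both indices lie in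
  `K = [k₀, k₀ + J)` where `ρ_{k₀} ≤ 2ε` is the first such scale and `2εL/π < 2^J`, `J ≤ 2εL/π`;
* swapping the sums, `Σ_{k ∈ K} f(k) ≤ (32 + B₁ε₀²)L² · 4ε/ε₀ + 2B₂L · 2εL/π`.

Sources: standard Littlewood–Paley dyadic partition of unity and a geometric series; everything is
folklore real analysis over the tree's definitions. No definition, no named fact.
-/

namespace Summit.HubbardSuperconductivity.HubbardSuperconductivity.Theorems.WindowInfraredBound

-- summit = problem name (single-conjunct summit, D-0017): `HubbardSuperconductivity` occurs twice in the path
set_option linter.dupNamespace false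

open Literature.MathematicalPhysics.QuantumLattice Literature.Probability.LatticeModels Matrix Finset
open scoped ComplexOrder ComplexConjugate
open Summit.HubbardSuperconductivity.HubbardSuperconductivity.Theses

/-! ## §1 Pure real analysis: the cascade, the log-tent, the dyadic scales -/

-- adapted from Cruxes/WindowInfraredBound/SketchIdeator2.lean (`cascade_bound`)
/-- Closed-form cascade: a halving recursion `f(k+1) ≤ f(k)/2 + a/4^{k+1} + b` with `f(0) ≤ M`,
`a, b ≥ 0` gives `f(k) ≤ (M + a)/2^k + 2b` (via the sharper invariant
`f k ≤ M/2^k + a·2^{-k}(1 − 2^{-k}) + 2b(1 − 2^{-k})`). [folklore] -/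
theorem shellCover_cascade_bound {f : ℕ → ℝ} {M a b : ℝ} (ha : 0 ≤ a) (hb : 0 ≤ b) (h0 : f 0 ≤ M)
    (hstep : ∀ k, f (k + 1) ≤ f k / 2 + a / 4 ^ (k + 1) + b) (k : ℕ) :
    f k ≤ (M + a) / 2 ^ k + 2 * b := by
  have key : ∀ k : ℕ,
      f k ≤ M / 2 ^ k + a * (1 / 2 ^ k) * (1 - 1 / 2 ^ k) + 2 * b * (1 - 1 / 2 ^ k) := by
    intro k
    induction k with
    | zero => simpa using h0
    | succ n ih =>
      have h2 : (0 : ℝ) < 2 ^ n := pow_pos two_pos n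
      have hs := hstep n
      have e4 : (4 : ℝ) ^ (n + 1) = (2 ^ (n + 1)) ^ 2 := by
        rw [← pow_mul, show (4 : ℝ) = 2 ^ 2 by norm_num, ← pow_mul, mul_comm]
      rw [e4] at hs
      have e2 : (2 : ℝ) ^ (n + 1) = 2 * 2 ^ n := by rw [pow_succ, mul_comm]
      rw [e2] at hs ⊢
      set t : ℝ := 1 / 2 ^ n with ht
      have ht0 : 0 < t := by rw [ht]; positivity
      have ht1 : t ≤ 1 := by
        rw [ht, div_le_one h2]; exact one_le_pow₀ (by norm_num)
      have hM : M / 2 ^ n = M * t := by rw [ht]; field_simp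
      have hM' : M / (2 * 2 ^ n) = M * t / 2 := by rw [ht]; field_simp
      have hq : (1 : ℝ) / (2 * 2 ^ n) = t / 2 := by rw [ht]; field_simp
      have hq2 : a / (2 * 2 ^ n) ^ 2 = a * t ^ 2 / 4 := by rw [ht]; field_simp; ring
      rw [hM] at ih
      rw [hM', hq]
      rw [hq2] at hs
      nlinarith [ih, hs, ht0, ht1, ha, hb, sq_nonneg t]
  have h2k : (0 : ℝ) < 2 ^ k := pow_pos two_pos k
  have hk := key k
  have ht1 : (1 : ℝ) / 2 ^ k ≤ 1 := by
    rw [div_le_one h2k]; exact one_le_pow₀ (by norm_num)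
  have ht0 : (0 : ℝ) < 1 / 2 ^ k := by positivity
  rw [add_div, div_eq_mul_one_div M, div_eq_mul_one_div a]
  rw [div_eq_mul_one_div M] at hk
  set t : ℝ := 1 / 2 ^ k with ht
  have h1 : 0 ≤ a * (t * t) := mul_nonneg ha (mul_nonneg ht0.le ht0.le)
  have h2 : 0 ≤ b * t := mul_nonneg hb ht0.le
  nlinarith [hk, h1, h2]

-- adapted from Cruxes/WindowInfraredBound/SketchIdeator2.lean (`lpTent_add_lpTent_two_mul`)
/-- Local partition of unity of the log-tent: `φ(v) + φ(2v) = 1` on `[1/2, 1]`,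
`φ(u) = max 0 (1 − |log₂ u|)`. [folklore] -/
theorem shellCover_tent_add_tent_two_mul {v : ℝ} (hv : v ∈ Set.Icc (1 / 2 : ℝ) 1) :
    max 0 (1 - |Real.logb 2 v|) + max 0 (1 - |Real.logb 2 (2 * v)|) = 1 := by
  obtain ⟨hv1, hv2⟩ := hv
  have hvpos : 0 < v := by linarith
  have hlog2 : Real.logb 2 (2 * v) = 1 + Real.logb 2 v := by
    rw [Real.logb_mul (by norm_num) hvpos.ne', Real.logb_self_eq_one (by norm_num)]
  have hle : Real.logb 2 v ≤ 0 := Real.logb_nonpos (by norm_num) hvpos.le hv2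
  have hge : -1 ≤ Real.logb 2 v := by
    have : Real.logb 2 (1 / 2) ≤ Real.logb 2 v :=
      Real.logb_le_logb_of_le (by norm_num) (by norm_num) hv1
    have h12 : Real.logb 2 (1 / 2) = -1 := by
      rw [one_div, Real.logb_inv, Real.logb_self_eq_one (by norm_num)]
    linarith
  rw [hlog2, abs_of_nonpos hle, abs_of_nonneg (by linarith), max_eq_right (by linarith),
    max_eq_right (by linarith)]
  ring

/-- `Σ_{j < J} (1/2)^j ≤ 2`. [folklore] -/
theorem shellCover_geom_sum_le_two (J : ℕ) : ∑ j ∈ Finset.range J, (1 / 2 : ℝ) ^ j ≤ 2 := by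
  rw [geom_sum_eq (by norm_num) J]
  have hp : (0 : ℝ) ≤ (1 / 2) ^ J := by positivity
  have : ((1 / 2 : ℝ) ^ J - 1) / (1 / 2 - 1) = 2 * (1 - (1 / 2) ^ J) := by ring
  rw [this]
  linarith

/-- The dyadic counting scale: for `x ≥ 0` the least `J` with `x < 2^J` has `J ≤ x` (as `J ≤ 2^{J-1}`,
`Nat.lt_two_pow_self`). [folklore] -/
theorem shellCover_exists_scaleCount {x : ℝ} (hx : 0 ≤ x) : ∃ J : ℕ, x < 2 ^ J ∧ (J : ℝ) ≤ x := by
  classical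
  have hex : ∃ J : ℕ, x < 2 ^ J := pow_unbounded_of_one_lt x one_lt_two
  refine ⟨Nat.find hex, Nat.find_spec hex, ?_⟩
  cases h : Nat.find hex with
  | zero => simpa using hx
  | succ n =>
    have hmin := Nat.find_min hex (show n < Nat.find hex by omega)
    push Not at hmin
    have h2 : n + 1 ≤ 2 ^ n := Nat.lt_two_pow_self
    calc ((n + 1 : ℕ) : ℝ) ≤ ((2 ^ n : ℕ) : ℝ) := by exact_mod_cast h2
      _ = 2 ^ n := by norm_cast
      _ ≤ x := hmin

/-- The first dyadic scale below a threshold: for `t > 0` there is a least `k₀` with `ε₀/2^{k₀} ≤ t`.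
[folklore] -/
theorem shellCover_exists_minScale (ε₀ : ℝ) {t : ℝ} (ht : 0 < t) :
    ∃ k₀ : ℕ, ε₀ / 2 ^ k₀ ≤ t ∧ ∀ k : ℕ, ε₀ / 2 ^ k ≤ t → k₀ ≤ k := by
  classical
  have hex : ∃ k : ℕ, ε₀ / 2 ^ k ≤ t := by
    obtain ⟨n, hn⟩ := pow_unbounded_of_one_lt (ε₀ / t) one_lt_two
    refine ⟨n, ?_⟩
    rw [div_lt_iff₀ ht] at hn
    rw [div_le_iff₀ (pow_pos two_pos n)]
    linarith
  exact ⟨Nat.find hex, Nat.find_spec hex, fun k hk => Nat.find_min' hex hk⟩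

/-- The dyadic scale of a point: for `0 < u ≤ ε₀` there is `k` with `ε₀/2^{k+1} ≤ u ≤ ε₀/2^k`
(the least `k` with `ε₀/2^k ≤ 2u`). [folklore] -/
theorem shellCover_exists_dyadicScale {ε₀ u : ℝ} (hu : 0 < u) (huε₀ : u ≤ ε₀) :
    ∃ k : ℕ, ε₀ / 2 ^ k ≤ 2 * u ∧ u ≤ ε₀ / 2 ^ k := by
  classical
  obtain ⟨k, hk, hkmin⟩ := shellCover_exists_minScale ε₀ (by positivity : (0 : ℝ) < 2 * u)
  refine ⟨k, hk, ?_⟩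
  cases hk0 : k with
  | zero => simpa using huε₀
  | succ n =>
    have hn : ¬ (ε₀ / 2 ^ n ≤ 2 * u) := fun h => by have := hkmin n h; omega
    push Not at hn
    rw [pow_succ, ← div_div]
    linarith

/-- **Pointwise shell cover.** For a momentum modulus `u ∈ [c, ε]` (`c > 0`, `0 < ε ≤ ε₀/2`) and a
weight `S ≥ 0`: with `k₀` the least scale index with `ε₀/2^{k₀} ≤ 2ε` and any `J` with `4ε/c < 2^J`,
`S ≤ Σ_{k ∈ [k₀, k₀+J)} φ(u/(ε₀/2^k)) · S` — the two tents at the dyadic scale `k*` of `u` and at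
`k* + 1` already sum to `1`, and `k₀ ≤ k* < k* + 1 < k₀ + J`. [folklore] -/
theorem shellCover_pointwise {ε₀ ε c u S : ℝ} {k₀ J : ℕ} (hε : 0 < ε) (hεε₀ : ε ≤ ε₀ / 2)
    (hc : 0 < c) (hcu : c ≤ u) (huε : u ≤ ε) (hS : 0 ≤ S)
    (hk₀ : ε₀ / 2 ^ k₀ ≤ 2 * ε) (hk₀min : ∀ k : ℕ, ε₀ / 2 ^ k ≤ 2 * ε → k₀ ≤ k)
    (hJ : 4 * ε / c < 2 ^ J) :
    S ≤ ∑ k ∈ Finset.Ico k₀ (k₀ + J), max 0 (1 - |Real.logb 2 (u / (ε₀ / 2 ^ k))|) * S := by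
  have hε₀ : 0 < ε₀ := by linarith
  have hu : 0 < u := lt_of_lt_of_le hc hcu
  obtain ⟨ks, hks1, hks2⟩ := shellCover_exists_dyadicScale (ε₀ := ε₀) hu (by linarith)
  have hρ : 0 < ε₀ / 2 ^ ks := by positivity
  -- `v = u / ρ_{k*} ∈ [1/2, 1]`
  have hv : u / (ε₀ / 2 ^ ks) ∈ Set.Icc (1 / 2 : ℝ) 1 := by
    constructor
    · rw [le_div_iff₀ hρ]; linarith
    · rw [div_le_one hρ]; exact hks2
  have hident := shellCover_tent_add_tent_two_mul hv
  have h2v : 2 * (u / (ε₀ / 2 ^ ks)) = u / (ε₀ / 2 ^ (ks + 1)) := by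
    rw [pow_succ]; field_simp
  rw [h2v] at hident
  -- membership of `k*` and `k* + 1` in `[k₀, k₀ + J)`
  have hk₀ks : k₀ ≤ ks := hk₀min ks (by linarith)
  have hksJ : ks + 1 < k₀ + J := by
    by_contra hcon
    push Not at hcon
    have hJle : J ≤ ks + 1 - k₀ := by omega
    have h1 : (2 : ℝ) ^ J ≤ 2 ^ (ks + 1 - k₀) := pow_le_pow_right₀ one_le_two hJle
    have h2 : (2 : ℝ) ^ (ks + 1 - k₀) ≤ 4 * ε / c := by
      rw [le_div_iff₀ hc]
      refine le_of_mul_le_mul_right ?_ (pow_pos two_pos k₀ : (0 : ℝ) < 2 ^ k₀)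
      have hA : u * 2 ^ ks ≤ ε₀ := by rwa [le_div_iff₀ (pow_pos two_pos _)] at hks2
      have hB : ε₀ ≤ 2 * ε * 2 ^ k₀ := by rwa [div_le_iff₀ (pow_pos two_pos _)] at hk₀
      calc (2 : ℝ) ^ (ks + 1 - k₀) * c * 2 ^ k₀ = c * (2 ^ (ks + 1 - k₀) * 2 ^ k₀) := by ring
        _ = c * 2 ^ (ks + 1) := by rw [← pow_add, Nat.sub_add_cancel (by omega)]
        _ = 2 * (c * 2 ^ ks) := by rw [pow_succ]; ring
        _ ≤ 2 * (u * 2 ^ ks) := by gcongr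
        _ ≤ 2 * (2 * ε * 2 ^ k₀) := by linarith
        _ = 4 * ε * 2 ^ k₀ := by ring
    linarith
  have hsub : ({ks, ks + 1} : Finset ℕ) ⊆ Finset.Ico k₀ (k₀ + J) := by
    rw [Finset.insert_subset_iff, Finset.singleton_subset_iff, Finset.mem_Ico, Finset.mem_Ico]
    omega
  calc S = max 0 (1 - |Real.logb 2 (u / (ε₀ / 2 ^ ks))|) * S +
        max 0 (1 - |Real.logb 2 (u / (ε₀ / 2 ^ (ks + 1)))|) * S := by
        rw [← add_mul, hident, one_mul]
    _ = ∑ k ∈ ({ks, ks + 1} : Finset ℕ), max 0 (1 - |Real.logb 2 (u / (ε₀ / 2 ^ k))|) * S := by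
        rw [Finset.sum_pair (show ks ≠ ks + 1 by omega)]
    _ ≤ ∑ k ∈ Finset.Ico k₀ (k₀ + J), max 0 (1 - |Real.logb 2 (u / (ε₀ / 2 ^ k))|) * S :=
        Finset.sum_le_sum_of_subset_of_nonneg hsub fun k _ _ => mul_nonneg (le_max_left _ _) hS

/-- **Summing the cascade over the active scales.** If `f(k) ≤ (32L² + B₁ε₀²L²)/2^k + 2B₂L` for all
`k`, `ε₀/2^{k₀} ≤ 2ε` and `J ≤ 2εL/π`, then
`Σ_{k ∈ [k₀, k₀+J)} f(k) ≤ (8(32 + B₁ε₀²)/ε₀ + 4B₂) ε L²` (geometric series `≤ 2/2^{k₀} ≤ 4ε/ε₀`, and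
`J · 2B₂L ≤ 4B₂εL²/π ≤ 4B₂εL²`). [folklore] -/
theorem shellCover_sum_scales {f : ℕ → ℝ} {ε₀ ε B₁ B₂ Lr : ℝ} {k₀ J : ℕ} (hε : 0 < ε) (hε₀ : 0 < ε₀)
    (hB₁ : 0 ≤ B₁) (hB₂ : 0 ≤ B₂) (hL : 0 < Lr)
    (hf : ∀ k : ℕ, f k ≤ (32 * Lr ^ 2 + B₁ * ε₀ ^ 2 * Lr ^ 2) / 2 ^ k + 2 * (B₂ * Lr))
    (hk₀ : ε₀ / 2 ^ k₀ ≤ 2 * ε) (hJ : (J : ℝ) ≤ 2 * ε * Lr / Real.pi) :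
    ∑ k ∈ Finset.Ico k₀ (k₀ + J), f k ≤ (8 * (32 + B₁ * ε₀ ^ 2) / ε₀ + 4 * B₂) * ε * Lr ^ 2 := by
  set A : ℝ := 32 * Lr ^ 2 + B₁ * ε₀ ^ 2 * Lr ^ 2 with hA
  have hA0 : 0 ≤ A := by rw [hA]; positivity
  -- `1/2^{k₀} ≤ 2ε/ε₀`
  have hk₀' : 1 / (2 : ℝ) ^ k₀ ≤ 2 * ε / ε₀ := by
    rw [div_le_iff₀ (pow_pos two_pos _)] at hk₀
    rw [div_le_div_iff₀ (pow_pos two_pos _) hε₀, one_mul]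
    linarith
  have hterm : ∀ j : ℕ, f (k₀ + j) ≤ A * (2 * ε / ε₀) * (1 / 2) ^ j + 2 * (B₂ * Lr) := by
    intro j
    refine (hf (k₀ + j)).trans (add_le_add ?_ le_rfl)
    calc A / 2 ^ (k₀ + j) = A * (1 / 2 ^ k₀) * (1 / 2) ^ j := by
          rw [pow_add, div_pow, one_pow]; field_simp
      _ ≤ A * (2 * ε / ε₀) * (1 / 2) ^ j := by gcongr
  have hπ : (1 : ℝ) ≤ Real.pi := by linarith [Real.two_le_pi]
  calc ∑ k ∈ Finset.Ico k₀ (k₀ + J), f k = ∑ j ∈ Finset.range J, f (k₀ + j) := by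
        rw [Finset.sum_Ico_eq_sum_range, Nat.add_sub_cancel_left]
    _ ≤ ∑ j ∈ Finset.range J, (A * (2 * ε / ε₀) * (1 / 2) ^ j + 2 * (B₂ * Lr)) :=
        Finset.sum_le_sum fun j _ => hterm j
    _ = A * (2 * ε / ε₀) * ∑ j ∈ Finset.range J, (1 / 2 : ℝ) ^ j + (J : ℝ) * (2 * (B₂ * Lr)) := by
        rw [Finset.sum_add_distrib, ← Finset.mul_sum, Finset.sum_const, Finset.card_range,
          nsmul_eq_mul]
    _ ≤ A * (2 * ε / ε₀) * 2 + 2 * ε * Lr / Real.pi * (2 * (B₂ * Lr)) := by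
        gcongr
        exact shellCover_geom_sum_le_two J
    _ = 4 * (A * ε / ε₀) + 4 * B₂ * ε * Lr ^ 2 / Real.pi := by ring
    _ ≤ 8 * (A * ε / ε₀) + 4 * B₂ * ε * Lr ^ 2 := by
        have h1 : 0 ≤ A * ε / ε₀ := by positivity
        have h2 : 4 * B₂ * ε * Lr ^ 2 / Real.pi ≤ 4 * B₂ * ε * Lr ^ 2 :=
          div_le_self (by positivity) hπ
        linarith
    _ = (8 * (32 + B₁ * ε₀ ^ 2) / ε₀ + 4 * B₂) * ε * Lr ^ 2 := by rw [hA]; ring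

/-! ## §2 The torus facts: smallest nonzero momentum, the Parseval anchor -/

-- adapted from Theorems/WindowInfraredBound/Negative/ParsevalCeiling.lean (`one_le_sum_valMinAbs_sq`)
/-- A nonzero momentum label has `Σᵢ (valMinAbs mᵢ)² ≥ 1`. [folklore] -/
theorem shellCover_one_le_sum_valMinAbs_sq {L : ℕ} {m : TorusSite 2 L} (hm : m ≠ 0) :
    (1 : ℝ) ≤ ∑ i, (((m i).valMinAbs : ℤ) : ℝ) ^ 2 := by
  obtain ⟨i, hi⟩ : ∃ i, m i ≠ 0 := by
    by_contra h
    push Not at h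
    exact hm (funext h)
  have hv : (m i).valMinAbs ≠ 0 := fun h => hi ((ZMod.valMinAbs_eq_zero (m i)).1 h)
  have h1 : (1 : ℝ) ≤ (((m i).valMinAbs : ℤ) : ℝ) ^ 2 := by
    have : (1 : ℤ) ≤ (m i).valMinAbs ^ 2 := by
      have := Int.one_le_abs hv
      nlinarith [abs_nonneg ((m i).valMinAbs), sq_abs ((m i).valMinAbs)]
    exact_mod_cast this
  exact h1.trans (Finset.single_le_sum (f := fun i => (((m i).valMinAbs : ℤ) : ℝ) ^ 2)
    (fun j _ => sq_nonneg _) (Finset.mem_univ i))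

/-- The smallest nonzero momentum modulus: `2π/L ≤ |q_m|` for `m ≠ 0`. [folklore] -/
theorem shellCover_le_sqrt_momentumNormSq (L : ℕ) [NeZero L] {m : TorusSite 2 L} (hm : m ≠ 0) :
    2 * Real.pi / (L : ℝ) ≤ Real.sqrt (momentumNormSq L m) := by
  have hc : (0 : ℝ) ≤ 2 * Real.pi / (L : ℝ) := by positivity
  rw [momentumNormSq_apply, Real.sqrt_mul' _ (Finset.sum_nonneg fun _ _ => sq_nonneg _),
    Real.sqrt_sq hc]
  exact le_mul_of_one_le_right hc (Real.one_le_sqrt.2 (shellCover_one_le_sum_valMinAbs_sq hm))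

-- adapted from Cruxes/WindowInfraredBound/SketchIdeator2.lean (`shellSum_le_apriori`)
/-- **The anchor is free**: every smooth shell sum is `≤ Σ_m S_ψ(m) ≤ 32 L²` for a normalised Fock
vector (`0 ≤ φ ≤ 1`, `S_ψ ≥ 0`, landed Parseval ceiling `wib_sum_pairStructureFactor_le`). [folklore] -/
theorem shellCover_shellSum_le (L : ℕ) [NeZero L] (ψ : Fock (Orb (FermionTorus 2 L)))
    (hψ : star ψ ⬝ᵥ ψ = 1) (ρ : ℝ) :
    (∑ m : TorusSite 2 L, if m ≠ 0 then
        max 0 (1 - |Real.logb 2 (Real.sqrt (momentumNormSq L m) / ρ)|) *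
          pairStructureFactor dWaveFormFactor L ψ m else 0) ≤ 32 * (L : ℝ) ^ 2 := by
  refine le_trans (Finset.sum_le_sum fun m _ => ?_) (wib_sum_pairStructureFactor_le L ψ hψ)
  have hS : 0 ≤ pairStructureFactor dWaveFormFactor L ψ m := pairStructureFactor_nonneg _ _ _ _
  split_ifs
  · have habs : 0 ≤ |Real.logb 2 (Real.sqrt (momentumNormSq L m) / ρ)| := abs_nonneg _
    have h1 : max 0 (1 - |Real.logb 2 (Real.sqrt (momentumNormSq L m) / ρ)|) ≤ 1 :=
      max_le zero_le_one (by linarith)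
    calc max 0 (1 - |Real.logb 2 (Real.sqrt (momentumNormSq L m) / ρ)|) *
          pairStructureFactor dWaveFormFactor L ψ m
        ≤ 1 * pairStructureFactor dWaveFormFactor L ψ m := mul_le_mul_of_nonneg_right h1 hS
      _ = pairStructureFactor dWaveFormFactor L ψ m := one_mul _
  · exact hS

/-! ## §3 The stub -/

/-- **Stub `stub_shellCover` (single-state Littlewood–Paley cover + geometric cascade).**
For ONE Fock vector `ψ` with `⟨ψ, ψ⟩ = 1` on ONE torus: if the halving inequality (Dbl) holds for this
`ψ` at every scale `0 < ρ ≤ ε₀/2` with constants `B₁, B₂ ≥ 0`, then for `0 < ε ≤ ε₀/2` the sharp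
window sum obeys `Σ_{m ≠ 0, |q_m|² ≤ ε²} S_ψ(m) ≤ (8(32 + B₁ε₀²)/ε₀ + 4B₂) · ε · L²`.
Route: anchor `f(k) ≤ 32L²`; (Dbl) at `ρ = ε₀2^{-(k+1)}` is `f(k+1) ≤ f(k)/2 + B₁ε₀²L²/4^{k+1} + B₂L`,
so `f(k) ≤ (32 + B₁ε₀²)L²/2^k + 2B₂L` (`shellCover_cascade_bound`); pointwise cover
`1_{0<|q|≤ε} S ≤ Σ_{k ∈ [k₀, k₀+J)} φ(|q|/ρ_k) S` (`shellCover_pointwise`); swap the sums and sum the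
cascade over the `J ≤ 2εL/π` active scales (`shellCover_sum_scales`). [folklore] -/
theorem stub_shellCover (L : ℕ) [NeZero L] (ψ : Fock (Orb (FermionTorus 2 L))) (hψ : star ψ ⬝ᵥ ψ = 1)
    {B₁ B₂ ε₀ ε : ℝ} (hB₁ : 0 ≤ B₁) (hB₂ : 0 ≤ B₂) (hε : 0 < ε) (hεε₀ : ε ≤ ε₀ / 2)
    (hDbl : ∀ ρ ∈ Set.Ioc (0:ℝ) (ε₀ / 2),
      (∑ m : TorusSite 2 L, if m ≠ 0 then
          max 0 (1 - |Real.logb 2 (Real.sqrt (momentumNormSq L m) / ρ)|) *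
            pairStructureFactor dWaveFormFactor L ψ m else 0) ≤
        (∑ m : TorusSite 2 L, if m ≠ 0 then
            max 0 (1 - |Real.logb 2 (Real.sqrt (momentumNormSq L m) / (2 * ρ))|) *
              pairStructureFactor dWaveFormFactor L ψ m else 0) / 2 +
          B₁ * ρ ^ 2 * (L : ℝ) ^ 2 + B₂ * (L : ℝ)) :
    (∑ m : TorusSite 2 L, if m ≠ 0 ∧ momentumNormSq L m ≤ ε ^ 2 then
        pairStructureFactor dWaveFormFactor L ψ m else 0) ≤
      (8 * (32 + B₁ * ε₀ ^ 2) / ε₀ + 4 * B₂) * ε * (L : ℝ) ^ 2 := by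
  have hε₀ : 0 < ε₀ := by linarith
  have hL : (0 : ℝ) < (L : ℝ) := Nat.cast_pos.2 (Nat.pos_of_ne_zero (NeZero.ne L))
  have hc : (0 : ℝ) < 2 * Real.pi / (L : ℝ) := by positivity
  -- the active scales `[k₀, k₀ + J)`
  obtain ⟨k₀, hk₀, hk₀min⟩ := shellCover_exists_minScale ε₀ (by positivity : (0 : ℝ) < 2 * ε)
  obtain ⟨J, hJ, hJle⟩ := shellCover_exists_scaleCount (x := 2 * ε * (L : ℝ) / Real.pi)
    (by positivity)
  have hJ' : 4 * ε / (2 * Real.pi / (L : ℝ)) < 2 ^ J := by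
    have : 4 * ε / (2 * Real.pi / (L : ℝ)) = 2 * ε * (L : ℝ) / Real.pi := by
      field_simp; ring
    rw [this]; exact hJ
  -- the cascade bound on the smooth shell sums `f(k)`
  have hfk : ∀ k : ℕ, (∑ m : TorusSite 2 L, if m ≠ 0 then
      max 0 (1 - |Real.logb 2 (Real.sqrt (momentumNormSq L m) / (ε₀ / 2 ^ k))|) *
        pairStructureFactor dWaveFormFactor L ψ m else 0) ≤
      (32 * (L : ℝ) ^ 2 + B₁ * ε₀ ^ 2 * (L : ℝ) ^ 2) / 2 ^ k + 2 * (B₂ * (L : ℝ)) := by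
    refine shellCover_cascade_bound (f := fun k => ∑ m : TorusSite 2 L, if m ≠ 0 then
      max 0 (1 - |Real.logb 2 (Real.sqrt (momentumNormSq L m) / (ε₀ / 2 ^ k))|) *
        pairStructureFactor dWaveFormFactor L ψ m else 0) (M := 32 * (L : ℝ) ^ 2)
      (a := B₁ * ε₀ ^ 2 * (L : ℝ) ^ 2) (b := B₂ * (L : ℝ)) (by positivity) (by positivity)
      (shellCover_shellSum_le L ψ hψ _) fun k => ?_
    have hρ : ε₀ / 2 ^ (k + 1) ∈ Set.Ioc (0 : ℝ) (ε₀ / 2) :=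
      ⟨by positivity, div_le_div_of_nonneg_left hε₀.le two_pos
        (le_self_pow₀ one_le_two (Nat.succ_ne_zero k))⟩
    have hD := hDbl _ hρ
    have h2ρ : 2 * (ε₀ / 2 ^ (k + 1)) = ε₀ / 2 ^ k := by rw [pow_succ]; field_simp
    have h4 : ((2 : ℝ) ^ (k + 1)) ^ 2 = 4 ^ (k + 1) := by
      rw [← pow_mul, mul_comm, pow_mul]; norm_num
    have h4' : B₁ * (ε₀ / 2 ^ (k + 1)) ^ 2 * (L : ℝ) ^ 2 =
        B₁ * ε₀ ^ 2 * (L : ℝ) ^ 2 / 4 ^ (k + 1) := by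
      rw [div_pow, h4]; ring
    rw [h2ρ, h4'] at hD
    exact hD
  -- pointwise cover, then swap the sums
  calc (∑ m : TorusSite 2 L, if m ≠ 0 ∧ momentumNormSq L m ≤ ε ^ 2 then
          pairStructureFactor dWaveFormFactor L ψ m else 0)
      ≤ ∑ m : TorusSite 2 L, ∑ k ∈ Finset.Ico k₀ (k₀ + J), (if m ≠ 0 then
          max 0 (1 - |Real.logb 2 (Real.sqrt (momentumNormSq L m) / (ε₀ / 2 ^ k))|) *
            pairStructureFactor dWaveFormFactor L ψ m else 0) := by
        refine Finset.sum_le_sum fun m _ => ?_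
        by_cases hm : m ≠ 0 ∧ momentumNormSq L m ≤ ε ^ 2
        · rw [if_pos hm]
          simp_rw [if_pos hm.1]
          refine shellCover_pointwise hε hεε₀ hc (shellCover_le_sqrt_momentumNormSq L hm.1) ?_
            (pairStructureFactor_nonneg _ _ _ _) hk₀ hk₀min hJ'
          calc Real.sqrt (momentumNormSq L m) ≤ Real.sqrt (ε ^ 2) := Real.sqrt_le_sqrt hm.2
            _ = ε := Real.sqrt_sq hε.le
        · rw [if_neg hm]
          refine Finset.sum_nonneg fun k _ => ?_
          split_ifs
          · exact mul_nonneg (le_max_left _ _) (pairStructureFactor_nonneg _ _ _ _)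
          · exact le_rfl
    _ = ∑ k ∈ Finset.Ico k₀ (k₀ + J), ∑ m : TorusSite 2 L, (if m ≠ 0 then
          max 0 (1 - |Real.logb 2 (Real.sqrt (momentumNormSq L m) / (ε₀ / 2 ^ k))|) *
            pairStructureFactor dWaveFormFactor L ψ m else 0) := Finset.sum_comm
    _ ≤ (8 * (32 + B₁ * ε₀ ^ 2) / ε₀ + 4 * B₂) * ε * (L : ℝ) ^ 2 :=
        shellCover_sum_scales hε hε₀ hB₁ hB₂ hL hfk hk₀ hJle

end Summit.HubbardSuperconductivity.HubbardSuperconductivity.Theorems.WindowInfraredBound
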